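import Literature.AlgebraicGeometry.Resolution.RsopMonomialIdeals
import Literature.AlgebraicGeometry.Resolution.RegularCentreLocal
import Literature.AlgebraicGeometry.Resolution.QuasiRegularSequences
import Literature.AlgebraicGeometry.Resolution.RegularLocalRingsProofs
import Mathlib.RingTheory.Localization.LocalizationLocalization
import HarnessLib

/-!
# Spreading a part of a regular system of parameters to a quasi-regular sequence

Topic: `Literature/AlgebraicGeometry/Resolution` (theorems only, no named facts). Commutative algebra
for the local-to-global step of Bertini-type constructions (the centre of a blow-up chosen by generic
linear forms is regular AT THE CLOSED POINTS; one needs a quasi-regular generating sequence with regular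
quotient ring ON A NEIGHBOURHOOD):

* `isRegularRing_of_isRegularLocalRing_maximal` — **a Noetherian ring is regular as soon as its
  localisations at the maximal ideals are regular local rings** (Serre's localisation theorem,
  Matsumura Thm. 19.3, through the tree's `isRegularLocalRing_localization_atPrime`);
  `isRegularRing_quotient_of_localization_maximal` — the same for a quotient `A/I`, tested on
  localisations `R` of `A` at the maximal ideals above `I` (cf. `isRegularRing_quotient_of_localization`,
  all primes);
* `IsRsopPart.mem_of_mul_mem` — **a part of a regular system of parameters is a regular sequence**
  (colon form `zᵢ y ∈ (z_{<i}) ⇒ y ∈ (z_{<i})`; Matsumura Thms. 14.2–14.3 via the tree's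
  `isRegular_of_span_eq_maximalIdeal`);
* `exists_isQuasiRegular_away_of_isRsopPart` — **if the images of `u₁, …, u_c ∈ A` in `A_p` are part of a
  regular system of parameters, then on some `D(g) ∋ p` they form a quasi-regular sequence** (uniform
  multiplier `exists_uniform_multiplier_of_regular_at_prime` + Rees `isQuasiRegular_of_regularSeq`,
  Matsumura Thm. 16.2 (i)).

## References

* [Matsumura1987] H. Matsumura, Commutative Ring Theory, CUP 1986/1989, Thms. 14.2, 14.3, 16.2, 19.3.
-/

noncomputable section

open IsLocalRing

universe u

namespace Literature.AlgebraicGeometry.Resolution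

/-! ## Regularity at the maximal ideals suffices -/

/-- **A Noetherian ring whose localisations at MAXIMAL ideals are regular local rings is a regular
ring** (the localisation at a prime `p ⊆ m` is a localisation of the regular local ring `R_m`, hence
regular by Serre's theorem, Matsumura Thm. 19.3). [cite: Matsumura1987, Thm. 19.3] -/
theorem isRegularRing_of_isRegularLocalRing_maximal {R : Type u} [CommRing R] [IsNoetherianRing R]
    (h : ∀ (m : Ideal R) [m.IsMaximal], IsRegularLocalRing (Localization.AtPrime m)) :
    IsRegularRing R := by
  refine isRegularRing_iff.mpr fun p hp => ?_
  obtain ⟨m, hm, hpm⟩ := Ideal.exists_le_maximal p hp.ne_top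
  haveI := h m
  -- `p R_m` is a prime of `R_m` lying over `p`
  have hdisj : Disjoint (m.primeCompl : Set R) (p : Set R) := by
    rw [Set.disjoint_left]
    intro x hx hxp
    exact hx (hpm hxp)
  haveI hP : (p.map (algebraMap R (Localization.AtPrime m))).IsPrime :=
    IsLocalization.isPrime_of_isPrime_disjoint m.primeCompl _ p hp hdisj
  have hcomap : (p.map (algebraMap R (Localization.AtPrime m))).comap
      (algebraMap R (Localization.AtPrime m)) = p :=
    IsLocalization.under_map_of_isPrime_disjoint m.primeCompl (Localization.AtPrime m) hp hdisj
  -- `R_p ≅ (R_m)_{p R_m}`, a localisation of a regular local ring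
  set T := Localization.AtPrime (p.map (algebraMap R (Localization.AtPrime m))) with hT
  haveI : IsRegularLocalRing T := isRegularLocalRing_localization_atPrime _ _
  have hloc : IsLocalization.AtPrime T ((p.map (algebraMap R (Localization.AtPrime m))).comap
      (algebraMap R (Localization.AtPrime m))) := inferInstance
  have hM : ((p.map (algebraMap R (Localization.AtPrime m))).comap
      (algebraMap R (Localization.AtPrime m))).primeCompl = p.primeCompl := by
    ext x
    change x ∉ _ ↔ x ∉ p
    rw [hcomap]
    exact Iff.rfl
  change IsLocalization _ T at hloc
  rw [hM] at hloc
  haveI := hloc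
  exact IsRegularLocalRing.of_ringEquiv
    (IsLocalization.algEquiv p.primeCompl T (Localization.AtPrime p)).toRingEquiv

/-- **Regularity of a quotient is local at the maximal ideals**: if `A` is Noetherian and for every
MAXIMAL `P ⊇ I` some localisation `R` of `A` at `P` has `R / I R` a regular local ring, then `A / I` is a
regular ring (cf. `isRegularRing_quotient_of_localization`, all primes). [folklore] -/
theorem isRegularRing_quotient_of_localization_maximal {A : Type u} [CommRing A] [IsNoetherianRing A]
    (I : Ideal A)
    (hloc : ∀ (P : Ideal A) [P.IsMaximal], I ≤ P →
      ∃ (R : Type u) (_ : CommRing R) (_ : Algebra A R) (_ : IsLocalization.AtPrime R P),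
        IsRegularLocalRing (R ⧸ I.map (algebraMap A R))) :
    IsRegularRing (A ⧸ I) := by
  refine isRegularRing_of_isRegularLocalRing_maximal fun Qbar hQbar => ?_
  set Q : Ideal A := Qbar.comap (Ideal.Quotient.mk I) with hQ
  haveI hQp : Q.IsMaximal := Ideal.comap_isMaximal_of_surjective _ Ideal.Quotient.mk_surjective
  have hIQ : I ≤ Q := fun a ha => by
    rw [hQ, Ideal.mem_comap, Ideal.Quotient.eq_zero_iff_mem.mpr ha]; exact Ideal.zero_mem _
  obtain ⟨R, _, _, _, hR⟩ := hloc Q hIQ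
  have hmemQ : ∀ c : A, Ideal.Quotient.mk I c ∈ Qbar ↔ c ∈ Q := fun c => by rw [hQ, Ideal.mem_comap]
  have hM : Algebra.algebraMapSubmonoid (A ⧸ I) Q.primeCompl = Qbar.primeCompl := by
    ext b
    constructor
    · rintro ⟨c, hc, rfl⟩
      exact fun h => hc ((hmemQ c).mp h)
    · intro hb
      obtain ⟨c, rfl⟩ := Ideal.Quotient.mk_surjective b
      exact ⟨c, fun h => hb ((hmemQ c).mpr h), rfl⟩
  haveI : IsLocalization.AtPrime (R ⧸ I.map (algebraMap A R)) Qbar := by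
    have := (inferInstance : IsLocalization (Algebra.algebraMapSubmonoid (A ⧸ I) Q.primeCompl)
      (R ⧸ I.map (algebraMap A R)))
    rwa [hM] at this
  exact IsRegularLocalRing.of_ringEquiv (IsLocalization.algEquiv Qbar.primeCompl
    (R ⧸ I.map (algebraMap A R)) (Localization.AtPrime Qbar)).toRingEquiv

/-! ## Part of a regular system of parameters: the colon form of a regular sequence -/

/-- **A part of a regular system of parameters is a regular sequence** (colon form): if `z₁, …, z_n` is
part of a regular system of parameters of `R`, then `zᵢ y ∈ (z_j : j < i)` implies `y ∈ (z_j : j < i)`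
(Matsumura Thms. 14.2, 14.3: the full system is an `R`-sequence, `isRegular_of_span_eq_maximalIdeal`).
[cite: Matsumura1987, Thm. 14.3] -/
theorem IsRsopPart.mem_of_mul_mem {R : Type u} [CommRing R] [IsLocalRing R] {n : ℕ} {z : Fin n → R}
    (hz : IsRsopPart z) (i : Fin n) (y : R) (hy : z i * y ∈ Ideal.span (z '' Set.Iio i)) :
    y ∈ Ideal.span (z '' Set.Iio i) := by
  haveI := hz.isRegularLocalRing
  obtain ⟨e, x, hrank, hspan, hxz⟩ := hz.exists_rsop
  have hlen : (List.ofFn x).length = ringKrullDim R := by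
    rw [List.length_ofFn, ← IsRegularLocalRing.spanFinrank_maximalIdeal, hrank]
  have hofList : Ideal.ofList (List.ofFn x) = Ideal.span (Set.range x) := by
    rw [Ideal.ofList]
    congr 1
    ext r
    simp [List.mem_ofFn']
  have hreg := isRegular_of_span_eq_maximalIdeal R (List.ofFn x) (by rw [hofList, hspan]) hlen
  have hw := hreg.toIsWeaklyRegular
  have hiL : (i : ℕ) < (List.ofFn x).length := by
    rw [List.length_ofFn]; omega
  have hi := (RingTheory.Sequence.isWeaklyRegular_iff_Fin R (List.ofFn x)).mp hw ⟨i, hiL⟩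
  rw [isSMulRegular_quotient_iff_mem_of_smul_mem] at hi
  have himg : x '' Set.Iio (Fin.castAdd e i) = z '' Set.Iio i := by
    ext r
    simp only [Set.mem_image, Set.mem_Iio]
    constructor
    · rintro ⟨l, hl, rfl⟩
      have hl' : (l : ℕ) < n := lt_of_lt_of_le (Fin.lt_def.mp hl) (by simp)
      refine ⟨⟨l, hl'⟩, ?_, ?_⟩
      · rw [Fin.lt_def] at hl ⊢; simpa using hl
      · rw [← hxz]; congr 1
    · rintro ⟨j, hj, rfl⟩
      refine ⟨Fin.castAdd e j, ?_, hxz j⟩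
      rw [Fin.lt_def] at hj ⊢; simpa using hj
  have htake : {r | r ∈ (List.ofFn x).take i} = z '' Set.Iio i := by
    rw [show (i : ℕ) = (Fin.castAdd e i : ℕ) from rfl, setOf_mem_take_ofFn, himg]
  have hxi : ∀ (hh : (i : ℕ) < n + e), x ⟨i, hh⟩ = z i := fun hh => hxz i
  have key := hi y
  simp only [Fin.getElem_fin, List.getElem_ofFn, smul_eq_mul, Ideal.mul_top, hxi] at key
  rw [Ideal.ofList, htake] at key
  exact key hy

/-! ## Spreading a part of a regular system of parameters to a quasi-regular sequence on a
neighbourhood -/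

/-- **Local-to-neighbourhood**: let `A` be Noetherian, `p` a prime and `u₁, …, u_c ∈ A` whose images in
`A_p` are part of a regular system of parameters. Then for some `g ∉ p` the images of the `uᵢ` in every
`A[1/g]` form a quasi-regular sequence (spread the `A_p`-sequence by a uniform multiplier,
`exists_uniform_multiplier_of_regular_at_prime`, and apply Rees' theorem
`isQuasiRegular_of_regularSeq`). [cite: Matsumura1987, Thm. 16.2 (i)] -/
theorem exists_isQuasiRegular_away_of_isRsopPart {A : Type u} [CommRing A] [IsNoetherianRing A]
    (p : Ideal A) [p.IsPrime] {c : ℕ} (u : Fin c → A)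
    (h : IsRsopPart (fun i => algebraMap A (Localization.AtPrime p) (u i))) :
    ∃ g : A, g ∉ p ∧ ∀ (L : Type u) [CommRing L] [Algebra A L] [IsLocalization.Away g L],
      IsQuasiRegular (fun i => algebraMap A L (u i)) := by
  -- colon form of the `A_p`-sequence, over `A`
  have hreg : ∀ (i : Fin c) (y : A), u i * y ∈ Ideal.span (u '' Set.Iio i) →
      ∃ s : A, s ∉ p ∧ s * y ∈ Ideal.span (u '' Set.Iio i) := by
    intro i y hy
    have himg : (fun i => algebraMap A (Localization.AtPrime p) (u i)) '' Set.Iio i =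
        algebraMap A (Localization.AtPrime p) '' (u '' Set.Iio i) := by
      rw [Set.image_image]
    have h1 : algebraMap A (Localization.AtPrime p) (u i) * algebraMap A (Localization.AtPrime p) y ∈
        Ideal.span ((fun i => algebraMap A (Localization.AtPrime p) (u i)) '' Set.Iio i) := by
      rw [himg, ← Ideal.map_span, ← map_mul]
      exact Ideal.mem_map_of_mem _ hy
    have h2 := h.mem_of_mul_mem i _ h1
    rw [himg, ← Ideal.map_span, IsLocalization.algebraMap_mem_map_algebraMap_iff p.primeCompl] at h2
    obtain ⟨s, hs, hsy⟩ := h2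
    exact ⟨s, hs, hsy⟩
  obtain ⟨g, hgp, hg⟩ := exists_uniform_multiplier_of_regular_at_prime u p hreg
  refine ⟨g, hgp, fun L _ _ _ => ?_⟩
  refine isQuasiRegular_of_regularSeq c _ fun i z hz => ?_
  have := regularSeq_map_of_uniform_multiplier u hg L i z
  exact this hz

end Literature.AlgebraicGeometry.Resolution

end
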